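import Summits.Parity.BatemanHorn.Theorems.SoloInformedTrapezoidBlockFirst
import Summits.Parity.BatemanHorn.Theorems.SoloInformedTrapezoidUniform

/-!
# The scale-profile hypothesis for the local `ℓ¹`-mean of the Hooley sums

Informed soloist `solo-Parity-informed` (session 144), conjunct `BatemanHorn`, the `d ≥ 3` rung BELOW the parity
wall.  `SoloInformedTrapezoidCancellation` derives Erdős's asymptotics `∑_{n≤x} τ(g(n)) ~ d·A_g·x log x` from the
local `ℓ¹`-mean hypothesis `HooleyMeanLocal g θ η`: a POWER saving `C·H·E^{1−η}` for
`∑_{h≤H} |∑_{E<e≤E'} S_g(±h; e)|` at EVERY frequency height `H ≤ E^θ` — at `H = 1` this asks for a pointwise power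
saving in the equidistribution of the roots of `g` modulo `e`, which is not known for any `g` of degree `≥ 3`.
Here the hypothesis is re-typed as the SCALE PROFILE the trapezoid method actually consumes
(`HooleyMeanProfile g θ η`): `∑_{h≤H} (|∑_{E<e≤E'} S_g(h;e)| + |∑ S_g(−h;e)|) ≤ εE + C·H·E^{1−η}` for
`E ≥ E₀(ε)` — an additive `o(E)` is free, so that at bounded frequencies only QUALITATIVE equidistribution of the
roots is asked (Hooley 1964, known for every irreducible `g`), and the power saving is asked only in the aspect of
the LENGTH `H` of the frequency average.  The method absorbs the `o(E)` because (i) below the frequency `E^σ`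
(`1 − 2/d < σ < η`) the Abel coefficients have total variation `O(D·X₁/E)` uniformly in the frequency
(`SoloInformedTrapezoidBlockFirst`), and (ii) above it the harmonic weights `1/h` charge the `o(E)` only `E^{−σ}`
and no logarithm (`sum_Ioc_div_le_of_partial_sums_le_affine`); the uniform block bound is
`SoloInformedTrapezoidProfileUniform`, the cancellation theorem `SoloInformedTrapezoidProfileCancellation`.
-/

namespace Summit.Parity.BatemanHorn.Theorems

open Finset Polynomial
open Literature.NumberTheory.Sieve (polyRootCountMod)

/-! ### The scale-profile hypothesis -/

/-- **HYPOTHESIS (scale profile of the local `ℓ¹`-mean).**  For every `ε > 0` there is `E₀` such that for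
`E₀ ≤ E ≤ E' ≤ 2E` and `H ≤ E^θ`:
`∑_{1≤h≤H} (|∑_{E<e≤E'} S_g(h;e)| + |∑_{E<e≤E'} S_g(−h;e)|) ≤ ε·E + C·H·E^{1−η}`.
At bounded `H` this is qualitative equidistribution of the roots of `g` modulo `e` (known); the power saving is in
the length `H` of the frequency average only.  `HooleyMeanLocal g θ η` is the case `ε = 0`. [this work] -/
def HooleyMeanProfile (g : ℤ[X]) (θ η : ℝ) : Prop :=
  ∃ C : ℝ, ∀ ε : ℝ, 0 < ε → ∃ E₀ : ℕ, ∀ E E' H : ℕ, E₀ ≤ E → 1 ≤ E → E ≤ E' → E' ≤ 2 * E →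
    (H : ℝ) ≤ (E : ℝ) ^ θ →
    ∑ h ∈ Icc 1 H, (‖∑ e ∈ Ioc E E', hooleySum g e h‖ + ‖∑ e ∈ Ioc E E', hooleySum g e (-(h : ℤ))‖)
      ≤ ε * E + C * H * (E : ℝ) ^ (1 - η)

/-- The local `ℓ¹`-mean hypothesis implies the scale profile (with `E₀ = 0`). [this work] -/
theorem HooleyMeanLocal.profile {g : ℤ[X]} {θ η : ℝ} (h : HooleyMeanLocal g θ η) :
    HooleyMeanProfile g θ η := by
  obtain ⟨C, hC⟩ := h
  refine ⟨C, fun ε hε => ⟨0, fun E E' H _ hE hEE' hE' hH => (hC E E' H hE hEE' hE' hH).trans ?_⟩⟩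
  have : 0 ≤ ε * (E : ℝ) := by positivity
  linarith

/-- Monotonicity in the saving exponent. [this work] -/
theorem HooleyMeanProfile.mono_right {g : ℤ[X]} {θ η η' : ℝ} (hη : η' ≤ η) (h : HooleyMeanProfile g θ η) :
    HooleyMeanProfile g θ η' := by
  obtain ⟨C, hC⟩ := h
  refine ⟨max C 0, fun ε hε => ?_⟩
  obtain ⟨E₀, hE₀⟩ := hC ε hε
  refine ⟨E₀, fun E E' H h0 hE hEE' hE' hH => (hE₀ E E' H h0 hE hEE' hE' hH).trans ?_⟩
  have hE1 : (1 : ℝ) ≤ E := by exact_mod_cast hE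
  have h1 : (E : ℝ) ^ (1 - η) ≤ (E : ℝ) ^ (1 - η') := Real.rpow_le_rpow_of_exponent_le hE1 (by linarith)
  have h2 : C * H * (E : ℝ) ^ (1 - η) ≤ max C 0 * H * (E : ℝ) ^ (1 - η) :=
    mul_le_mul_of_nonneg_right (mul_le_mul_of_nonneg_right (le_max_left _ _) (Nat.cast_nonneg _))
      (by positivity)
  have h3 : max C 0 * H * (E : ℝ) ^ (1 - η) ≤ max C 0 * H * (E : ℝ) ^ (1 - η') :=
    mul_le_mul_of_nonneg_left h1 (by positivity)
  linarith

/-- The constant may be taken nonnegative. [this work] -/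
theorem HooleyMeanProfile.exists_nonneg {g : ℤ[X]} {θ η : ℝ} (h : HooleyMeanProfile g θ η) :
    ∃ C : ℝ, 0 ≤ C ∧ ∀ ε : ℝ, 0 < ε → ∃ E₀ : ℕ, ∀ E E' H : ℕ, E₀ ≤ E → 1 ≤ E → E ≤ E' → E' ≤ 2 * E →
      (H : ℝ) ≤ (E : ℝ) ^ θ →
      ∑ h ∈ Icc 1 H, (‖∑ e ∈ Ioc E E', hooleySum g e h‖ + ‖∑ e ∈ Ioc E E', hooleySum g e (-(h : ℤ))‖)
        ≤ ε * E + C * H * (E : ℝ) ^ (1 - η) := by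
  obtain ⟨C, hC⟩ := h
  refine ⟨max C 0, le_max_right _ _, fun ε hε => ?_⟩
  obtain ⟨E₀, hE₀⟩ := hC ε hε
  refine ⟨E₀, fun E E' H h0 hE hEE' hE' hH => (hE₀ E E' H h0 hE hEE' hE' hH).trans ?_⟩
  have : 0 ≤ (H : ℝ) * (E : ℝ) ^ (1 - η) := by positivity
  nlinarith [le_max_left C 0]

/-! ### The split frequency -/

/-- The split frequency `H₀ = min(H, ⌊E^σ⌋)`: `H₀ ≤ H`, `H₀ ≤ E^σ`, `E^σ ≤ 4(H₀ + 1)` (given `σ ≤ θ`,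
`E ≥ 1`, `E^θ ≤ 4(H+1)`). [this work] -/
theorem trapSplit_choice {E H : ℕ} (hE : 1 ≤ E) {σ θ : ℝ} (hσθ : σ ≤ θ)
    (hH4 : (E : ℝ) ^ θ ≤ 4 * ((H : ℝ) + 1)) :
    min H ⌊(E : ℝ) ^ σ⌋₊ ≤ H ∧ ((min H ⌊(E : ℝ) ^ σ⌋₊ : ℕ) : ℝ) ≤ (E : ℝ) ^ σ
      ∧ (E : ℝ) ^ σ ≤ 4 * (((min H ⌊(E : ℝ) ^ σ⌋₊ : ℕ) : ℝ) + 1) := by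
  have hE1 : (1 : ℝ) ≤ E := by exact_mod_cast hE
  have hσ0 : 0 ≤ (E : ℝ) ^ σ := by positivity
  refine ⟨min_le_left _ _, ?_, ?_⟩
  · exact le_trans (by exact_mod_cast min_le_right _ _) (Nat.floor_le hσ0)
  · rcases min_choice H ⌊(E : ℝ) ^ σ⌋₊ with h | h <;> rw [h]
    · exact (Real.rpow_le_rpow_of_exponent_le hE1 hσθ).trans hH4
    · have := Nat.lt_floor_add_one ((E : ℝ) ^ σ)
      linarith

end Summit.Parity.BatemanHorn.Theorems
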